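import Summits.ValiantsHypothesis.ValiantsHypothesis.Theorems.LacunarySymmetroidMatrixDescartesCensusPivotTwoDescartes
import Summits.ValiantsHypothesis.ValiantsHypothesis.Theorems.LacunarySymmetroidMatrixDescartesCensusPivotKit

/-!
# `MatrixDescartes` census — pivot column at `m = 2`: TWO-DIRECTION pencils (the block / arrowhead family):
# `Z₊ ≤ 2·K_u·K_v`, hence `2(K − 1)` for one letter against a parallel pencil (sharp at `K = 3`), and the BLOCK normal form

HONEST FRAMING.  Object-search cell `pub-symmetroid`, Conjecture-B column in PIVOT currency (`…CensusPivotDefs.lean`, seat conjb-1),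
seat `val-sym-mdr-p1` (generation 12).  Helper file landed `--supports` the crux item stmt-ValiantsHypothesis-18050
(`Theses.LacunarySymmetroid.MatrixDescartes`, OPEN, on HOLD) with NO closure claim.  Partial UPPER rows of the `m = 2` pivot column
for ALL `K`, inside the HARD CELL (`det J < 0`, every letter pairing negatively with the pivot; the open part of the rows
`PivotRootLawAt 2 K q (2K)`, tree `…PivotTwoOffCell`, `…CensusPivotTwoCore`), on the sub-family whose letters point in at most TWO
directions: `Pₖ = cₖ · w(sideₖ) w(sideₖ)ᵀ`, `cₖ ≥ 0`, `w : Bool → ℝ²`.  This is the family of the tree's `2K` certificates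
(`…PivotTwoFiveTen`, `…PivotTwoSixTwelve`, the balanced arrowheads `…PivotArrow*`: letters `[[a/U, ±a], [±a, aU]]` = directions
`(1, ±U)`, up to rank-two «slacks» on the two extreme letters).

RESULTS (all `K`, all exponents, any real `2 × 2` pivot `J` with `det J ≤ 0` and both pairings
`m(J,w) = J₀₀w₁² + J₁₁w₀² − (J₀₁+J₁₀)w₀w₁ ≤ 0` — no index hypothesis):
* `det_twoDir`: `det (X^e J + f·u uᵀ + g·v vᵀ) = X^{2e} det J + X^e f·m(J,u) + X^e g·m(J,v) + f g·(u₀v₁ − u₁v₀)²` for the two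
  direction posynomials `f, g`; so a POSITIVE coefficient of `det F` can only sit at a CROSS pair sum `dₖ + d_l`
  (`coeff_det_pos_mem`), and Descartes with a positive-support budget (`card_posRoots_le_two_mul_card_pos`, the tree's
  `Pivot.TwoDescartes` count applied to `−det F`) gives **`posRoots_le_two_mul_sides` / `pivotPosRoots_le_two_mul_sides`:
  `Z₊ ≤ 2 · K_u · K_v`** (`K_u + K_v = K` the numbers of letters in the two directions).
* **`posRoots_le_of_one_against_parallel`: ONE letter against `K − 1` PARALLEL letters ⇒ `Z₊ ≤ 2(K − 1)`** — two below the
  conjectured row `2K` and four below the Descartes ceiling `2K + 2` (`Pivot.TwoDescartes.pivotTwo_posRoots_le`), for every `K`,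
  inside the hard cell; `posRoots_eq_zero_of_parallel`: all letters parallel ⇒ NO positive root; `posRoots_le_eight_of_twoTwo`:
  two letters in each direction ⇒ `Z₊ ≤ 8`, i.e. the open `(2,4)₁` content («nine or ten», desk R2312) needs ≥ 3 letter directions.
* SHARPNESS at `K = 3` is an integer certificate in the companion file `…PivotTwoDirectionsSharp` (`Z₊ = 4 = 2(K − 1)` for
  pivot `diag(3400, −3600)`, letters `(6/5)(1,1)(1,1)ᵀ`, `60X²(1,1)(1,1)ᵀ`, `180000X⁵(1,−1)(1,−1)ᵀ`; the general `(2,3)` row is `6`).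
* `block_factorisation` / `eval_det_eq_zero_iff_block` (the BLOCK NORMAL FORM): `Δ²·det F = (Δ²f + m_v X^e)(Δ²g + m_u X^e)
  + X^{2e}(Δ² det J − m_u m_v)`, i.e. for `x > 0` the roots are the solutions of ONE scalar equation
  `(F(x) − 1)(G(x) − 1) = μ²`, `F = Δ²f/(|m_v|x^e)`, `G = Δ²g/(|m_u|x^e)`, `μ² = 1 + Δ²|det J|/(m_u m_v) > 1`.

LOCATED, NOT ASSERTED (this seat, exact rational arithmetic on the tree's `(2,5)` TEN data, session exp/block22.py): the PURE blocks
(no slacks) of `…PivotTwoFiveTen` have exactly `6` (`K_u, K_v = 2, 2`, exponents `0,2 | 3 | 5,19`) and `8` (`2, 3`, `… 5,19,291`)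
positive roots = `2K − 2`, each slack adding one end crossing (`7`, then the tree's `8` / `10`).  BLOCK QUESTION (recorded for the
lineage, no credence attached): is `Z₊ ≤ 2K − 2` for every two-direction hard-cell pencil?  It is the `u = 2` instance of the
lineage's valley reading «at most `K` islands» (both end islands are unbounded for rank-one two-direction pencils), its first case
beyond this file is `(K_u, K_v) = (2, 2)`: «`(F − 1)(G − 1) = μ²` has at most six solutions for two-term `F, G`», where Descartes
allows eight exactly in the interleaving chambers; hub hill-climbs from the SIX block found no seventh solution (instrument-limited).
Nothing here bears on `Theses.LacunarySymmetroid.MatrixDescartes` in its window, on `KPlusLogSqLaw`, on `DoorA26` / `DoorA34`, on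
the cell's registers or credences, or on `VP ≠ VNP`.

[folklore] Descartes' rule of signs with a support budget (tree `Pivot.TwoDescartes.card_posRoots_le_two_mul_card`, Mathlib
`Polynomial.roots_neg`), `2 × 2` determinant algebra, IVT certificates via the tree's kit (`Pivot.le_pivotPosRoots_of_certificate`),
Mathlib `Matrix.posSemidef_vecMulVec_self_star`.  No definitions, no named facts.
-/

-- `Summit.ValiantsHypothesis.ValiantsHypothesis.…` repeats a component by the D-0017 layout
-- (single-conjunct summit), which the `dupNamespace` linter flags; the name is mandated.

set_option linter.dupNamespace false

namespace Summit.ValiantsHypothesis.ValiantsHypothesis.Theorems.LacunarySymmetroidMatrixDescartes.Pivot.TwoDirections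

open Polynomial Matrix Finset
open scoped BigOperators

variable {K : ℕ}

/-! ## 1. Descartes with a POSITIVE-support budget -/

/-- **Descartes with a positive-support budget**: if every positive coefficient of `P` sits in `T`, then `P` has at most
`2 · #T` distinct positive roots (the tree's negative-support count `Pivot.TwoDescartes.card_posRoots_le_two_mul_card`
applied to `−P`). [folklore] -/
theorem card_posRoots_le_two_mul_card_pos (P : ℝ[X]) (T : Finset ℕ) (hT : ∀ n, 0 < P.coeff n → n ∈ T) :
    (P.roots.toFinset.filter (fun t => 0 < t)).card ≤ 2 * T.card := by
  have h := TwoDescartes.card_posRoots_le_two_mul_card (-P) T (fun n hn => hT n (by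
    rw [Polynomial.coeff_neg] at hn; linarith))
  rwa [Polynomial.roots_neg] at h

/-! ## 2. The determinant of a two-direction pencil -/

/-- **Determinant of a two-direction pencil.**  For polynomials `f, g`, a real `2 × 2` matrix `J` and directions `u, v`:
`det (X^e J + f · u uᵀ + g · v vᵀ) = X^{2e} det J + X^e f · m(J,u) + X^e g · m(J,v) + f g · (u₀v₁ − u₁v₀)²`, where
`m(J,u) = J₀₀u₁² + J₁₁u₀² − (J₀₁+J₁₀)u₀u₁ = (u^⊥)ᵀ J u^⊥` is the pairing of `J` with the letter `u uᵀ` (the rank-one letters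
have zero determinant; the mixed discriminant of `u uᵀ, v vᵀ` is `(det[u v])²`). [folklore] -/
theorem det_twoDir (e : ℕ) (J : Matrix (Fin 2) (Fin 2) ℝ) (u v : Fin 2 → ℝ) (f g : ℝ[X]) :
    Matrix.det (((X : ℝ[X]) ^ e) • J.map Polynomial.C + f • (vecMulVec u u).map Polynomial.C
        + g • (vecMulVec v v).map Polynomial.C)
      = (X : ℝ[X]) ^ (2 * e) * Polynomial.C J.det
        + (X : ℝ[X]) ^ e * f * Polynomial.C (J 0 0 * u 1 ^ 2 + J 1 1 * u 0 ^ 2 - (J 0 1 + J 1 0) * (u 0 * u 1))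
        + (X : ℝ[X]) ^ e * g * Polynomial.C (J 0 0 * v 1 ^ 2 + J 1 1 * v 0 ^ 2 - (J 0 1 + J 1 0) * (v 0 * v 1))
        + f * g * Polynomial.C ((u 0 * v 1 - u 1 * v 0) ^ 2) := by
  rw [Matrix.det_fin_two, Matrix.det_fin_two]
  simp only [Matrix.add_apply, Matrix.smul_apply, Matrix.map_apply, Matrix.vecMulVec_apply, smul_eq_mul,
    map_sub, map_mul, map_add, map_pow]
  ring

/-- The letter sum of a two-direction family collapses to `f • u uᵀ + g • v vᵀ` with `f, g` the direction posynomials.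
[folklore] -/
theorem letters_eq_twoDir (d : Fin K → ℕ) (w : Bool → (Fin 2 → ℝ)) (side : Fin K → Bool) (c : Fin K → ℝ)
    (P : Fin K → Matrix (Fin 2) (Fin 2) ℝ) (hP : ∀ k, P k = c k • vecMulVec (w (side k)) (w (side k))) :
    ∑ k, ((X : ℝ[X]) ^ d k) • (P k).map Polynomial.C
      = (∑ k ∈ univ.filter (fun k => side k = false), Polynomial.C (c k) * (X : ℝ[X]) ^ d k)
            • (vecMulVec (w false) (w false)).map Polynomial.C
        + (∑ k ∈ univ.filter (fun k => side k = true), Polynomial.C (c k) * (X : ℝ[X]) ^ d k)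
            • (vecMulVec (w true) (w true)).map Polynomial.C := by
  have hsplit := (Finset.sum_filter_add_sum_filter_not univ (fun k => side k = false)
    (fun k => ((X : ℝ[X]) ^ d k) • (P k).map Polynomial.C)).symm
  rw [hsplit, Finset.sum_smul, Finset.sum_smul]
  have hterm : ∀ k, ((X : ℝ[X]) ^ d k) • (P k).map Polynomial.C
      = (Polynomial.C (c k) * (X : ℝ[X]) ^ d k) • (vecMulVec (w (side k)) (w (side k))).map Polynomial.C := by
    intro k
    rw [hP k]
    ext i j
    simp only [Matrix.smul_apply, Matrix.map_apply, smul_eq_mul, map_mul]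
    ring
  congr 1
  · refine Finset.sum_congr rfl fun k hk => ?_
    rw [Finset.mem_filter] at hk
    rw [hterm k, hk.2]
  · refine Finset.sum_congr (by ext k; simp) fun k hk => ?_
    rw [Finset.mem_filter] at hk
    rw [hterm k, hk.2]

/-! ## 3. Positive coefficients of a two-direction determinant live at the CROSS PAIR sums -/

/-- Coefficients of a direction posynomial `∑ C(cₖ) X^{dₖ}` are non-negative when all `cₖ ≥ 0`. [folklore] -/
theorem coeff_dirPoly_nonneg (d : Fin K → ℕ) (c : Fin K → ℝ) (hc : ∀ k, 0 ≤ c k) (A : Finset (Fin K)) (n : ℕ) :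
    0 ≤ (∑ k ∈ A, Polynomial.C (c k) * (X : ℝ[X]) ^ d k).coeff n := by
  rw [Polynomial.finsetSum_coeff]
  refine Finset.sum_nonneg fun k _ => ?_
  rw [Polynomial.coeff_C_mul, Polynomial.coeff_X_pow]
  split_ifs
  · simpa using hc k
  · simp

/-- The coefficient of `Xⁿ` in the product of the two direction posynomials vanishes unless `n = dₖ + d_l` for a CROSS pair
(`side k = false`, `side l = true`). [folklore] -/
theorem coeff_mul_dirPoly_eq_zero (d : Fin K → ℕ) (side : Fin K → Bool) (c : Fin K → ℝ) (n : ℕ)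
    (hn : ∀ k l, side k = false → side l = true → d k + d l ≠ n) :
    ((∑ k ∈ univ.filter (fun k => side k = false), Polynomial.C (c k) * (X : ℝ[X]) ^ d k)
        * (∑ l ∈ univ.filter (fun l => side l = true), Polynomial.C (c l) * (X : ℝ[X]) ^ d l)).coeff n = 0 := by
  rw [Finset.sum_mul_sum, Polynomial.finsetSum_coeff]
  refine Finset.sum_eq_zero fun k hk => ?_
  rw [Polynomial.finsetSum_coeff]
  refine Finset.sum_eq_zero fun l hl => ?_
  rw [Finset.mem_filter] at hk hl
  have e1 : Polynomial.C (c k) * (X : ℝ[X]) ^ d k * (Polynomial.C (c l) * (X : ℝ[X]) ^ d l)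
      = Polynomial.C (c k * c l) * (X : ℝ[X]) ^ (d k + d l) := by
    rw [map_mul, pow_add]; ring
  rw [e1, Polynomial.coeff_C_mul, Polynomial.coeff_X_pow, if_neg (Ne.symm (hn k l hk.2 hl.2)), mul_zero]

/-- **Sign law for two-direction pencils.**  If `det J ≤ 0` and both directions pair non-positively with `J`
(`m(J,u), m(J,v) ≤ 0` — the HARD CELL has `det J < 0` and all pairings negative), then every POSITIVE coefficient of
`det F` sits at a cross pair sum `dₖ + d_l` (`k` in direction `u`, `l` in direction `v`). [folklore] -/
theorem coeff_det_pos_mem (e : ℕ) (d : Fin K → ℕ) (J : Matrix (Fin 2) (Fin 2) ℝ) (w : Bool → (Fin 2 → ℝ))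
    (side : Fin K → Bool) (c : Fin K → ℝ) (hc : ∀ k, 0 ≤ c k) (P : Fin K → Matrix (Fin 2) (Fin 2) ℝ)
    (hP : ∀ k, P k = c k • vecMulVec (w (side k)) (w (side k))) (hJ : J.det ≤ 0)
    (hu : J 0 0 * w false 1 ^ 2 + J 1 1 * w false 0 ^ 2 - (J 0 1 + J 1 0) * (w false 0 * w false 1) ≤ 0)
    (hv : J 0 0 * w true 1 ^ 2 + J 1 1 * w true 0 ^ 2 - (J 0 1 + J 1 0) * (w true 0 * w true 1) ≤ 0)
    (n : ℕ)
    (hpos : 0 < (Matrix.det (((X : ℝ[X]) ^ e) • J.map Polynomial.C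
        + ∑ k, ((X : ℝ[X]) ^ d k) • (P k).map Polynomial.C)).coeff n) :
    n ∈ (univ.filter (fun x : Fin K × Fin K => side x.1 = false ∧ side x.2 = true)).image
        (fun x => d x.1 + d x.2) := by
  by_contra hnot
  have hn : ∀ k l, side k = false → side l = true → d k + d l ≠ n := by
    intro k l hk hl hkl
    exact hnot (Finset.mem_image.2 ⟨(k, l), Finset.mem_filter.2 ⟨Finset.mem_univ _, hk, hl⟩, hkl⟩)
  rw [letters_eq_twoDir d w side c P hP, ← add_assoc, det_twoDir] at hpos
  set f := ∑ k ∈ univ.filter (fun k => side k = false), Polynomial.C (c k) * (X : ℝ[X]) ^ d k with hf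
  set g := ∑ k ∈ univ.filter (fun k => side k = true), Polynomial.C (c k) * (X : ℝ[X]) ^ d k with hg
  have hf0 : ∀ m, 0 ≤ f.coeff m := fun m => coeff_dirPoly_nonneg d c hc _ m
  have hg0 : ∀ m, 0 ≤ g.coeff m := fun m => coeff_dirPoly_nonneg d c hc _ m
  have hfg : (f * g).coeff n = 0 := coeff_mul_dirPoly_eq_zero d side c n hn
  -- the four coefficients
  have h1 : ((X : ℝ[X]) ^ (2 * e) * Polynomial.C J.det).coeff n ≤ 0 := by
    rw [mul_comm, Polynomial.coeff_C_mul_X_pow]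
    split_ifs
    · exact hJ
    · exact le_rfl
  have h2 : ((X : ℝ[X]) ^ e * f * Polynomial.C
      (J 0 0 * w false 1 ^ 2 + J 1 1 * w false 0 ^ 2 - (J 0 1 + J 1 0) * (w false 0 * w false 1))).coeff n ≤ 0 := by
    rw [Polynomial.coeff_mul_C, mul_comm ((X : ℝ[X]) ^ e) f, Polynomial.coeff_mul_X_pow']
    split_ifs
    · exact mul_nonpos_iff.2 (Or.inl ⟨hf0 _, hu⟩)
    · simp
  have h3 : ((X : ℝ[X]) ^ e * g * Polynomial.C
      (J 0 0 * w true 1 ^ 2 + J 1 1 * w true 0 ^ 2 - (J 0 1 + J 1 0) * (w true 0 * w true 1))).coeff n ≤ 0 := by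
    rw [Polynomial.coeff_mul_C, mul_comm ((X : ℝ[X]) ^ e) g, Polynomial.coeff_mul_X_pow']
    split_ifs
    · exact mul_nonpos_iff.2 (Or.inl ⟨hg0 _, hv⟩)
    · simp
  have h4 : (f * g * Polynomial.C ((w false 0 * w true 1 - w false 1 * w true 0) ^ 2)).coeff n = 0 := by
    rw [Polynomial.coeff_mul_C, hfg, zero_mul]
  rw [Polynomial.coeff_add, Polynomial.coeff_add, Polynomial.coeff_add, h4] at hpos
  linarith

/-! ## 4. The count: `Z₊ ≤ 2 · K_u · K_v` — hence `2K − 2` for one letter against a parallel pencil -/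

/-- **Two-direction count.**  A `2 × 2` pencil `X^e J + ∑ₖ X^{dₖ} Pₖ` whose letters are non-negative multiples of TWO
rank-one matrices `u uᵀ, v vᵀ`, with `det J ≤ 0` and both pairings `m(J,u), m(J,v) ≤ 0`, has at most
`2 · K_u · K_v` distinct positive determinant roots (`K_u, K_v` = the numbers of letters in each direction):
Descartes with the positive-support budget `{dₖ + d_l : k ∈ u-side, l ∈ v-side}`. [folklore] -/
theorem posRoots_le_two_mul_sides (e : ℕ) (d : Fin K → ℕ) (J : Matrix (Fin 2) (Fin 2) ℝ) (w : Bool → (Fin 2 → ℝ))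
    (side : Fin K → Bool) (c : Fin K → ℝ) (hc : ∀ k, 0 ≤ c k) (P : Fin K → Matrix (Fin 2) (Fin 2) ℝ)
    (hP : ∀ k, P k = c k • vecMulVec (w (side k)) (w (side k))) (hJ : J.det ≤ 0)
    (hu : J 0 0 * w false 1 ^ 2 + J 1 1 * w false 0 ^ 2 - (J 0 1 + J 1 0) * (w false 0 * w false 1) ≤ 0)
    (hv : J 0 0 * w true 1 ^ 2 + J 1 1 * w true 0 ^ 2 - (J 0 1 + J 1 0) * (w true 0 * w true 1) ≤ 0) :
    ((Matrix.det (((X : ℝ[X]) ^ e) • J.map Polynomial.C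
        + ∑ k, ((X : ℝ[X]) ^ d k) • (P k).map Polynomial.C)).roots.toFinset.filter (fun t => 0 < t)).card
      ≤ 2 * ((univ.filter (fun k => side k = false)).card * (univ.filter (fun k => side k = true)).card) := by
  classical
  set T := (univ.filter (fun x : Fin K × Fin K => side x.1 = false ∧ side x.2 = true)).image
        (fun x => d x.1 + d x.2) with hT
  have hcount := card_posRoots_le_two_mul_card_pos _ T
    (fun n hn => coeff_det_pos_mem e d J w side c hc P hP hJ hu hv n hn)
  have hTcard : T.card ≤ (univ.filter (fun k => side k = false)).card * (univ.filter (fun k => side k = true)).card := by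
    refine le_trans Finset.card_image_le ?_
    rw [← Finset.card_product]
    refine Finset.card_le_card ?_
    intro x hx
    rw [Finset.mem_filter] at hx
    exact Finset.mem_product.2 ⟨Finset.mem_filter.2 ⟨Finset.mem_univ _, hx.2.1⟩, Finset.mem_filter.2 ⟨Finset.mem_univ _, hx.2.2⟩⟩
  exact hcount.trans (Nat.mul_le_mul_left _ hTcard)

/-- **ONE LETTER AGAINST A PARALLEL PENCIL: `Z₊ ≤ 2(K − 1)`.**  In the setting of `posRoots_le_two_mul_sides`, if exactly
one letter lies in direction `u` (all the other `K − 1` letters are parallel to `v`), then `Z₊ ≤ 2 · (K − 1)` — two below the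
conjectured row `2K` and four below the tree's Descartes ceiling `2K + 2`, for every `K` and every exponent configuration,
INSIDE the hard cell. [folklore] -/
theorem posRoots_le_of_one_against_parallel (e : ℕ) (d : Fin K → ℕ) (J : Matrix (Fin 2) (Fin 2) ℝ)
    (w : Bool → (Fin 2 → ℝ)) (side : Fin K → Bool) (c : Fin K → ℝ) (hc : ∀ k, 0 ≤ c k)
    (P : Fin K → Matrix (Fin 2) (Fin 2) ℝ) (hP : ∀ k, P k = c k • vecMulVec (w (side k)) (w (side k)))
    (hJ : J.det ≤ 0)
    (hu : J 0 0 * w false 1 ^ 2 + J 1 1 * w false 0 ^ 2 - (J 0 1 + J 1 0) * (w false 0 * w false 1) ≤ 0)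
    (hv : J 0 0 * w true 1 ^ 2 + J 1 1 * w true 0 ^ 2 - (J 0 1 + J 1 0) * (w true 0 * w true 1) ≤ 0)
    (hone : (univ.filter (fun k => side k = false)).card = 1) :
    ((Matrix.det (((X : ℝ[X]) ^ e) • J.map Polynomial.C
        + ∑ k, ((X : ℝ[X]) ^ d k) • (P k).map Polynomial.C)).roots.toFinset.filter (fun t => 0 < t)).card
      ≤ 2 * (K - 1) := by
  classical
  have h := posRoots_le_two_mul_sides e d J w side c hc P hP hJ hu hv
  have hK : (univ.filter (fun k : Fin K => side k = false)).card
      + (univ.filter (fun k : Fin K => side k = true)).card = K := by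
    have h1 := Finset.card_filter_add_card_filter_not (s := (univ : Finset (Fin K))) (fun k => side k = false)
    have h2 : (univ.filter (fun k : Fin K => ¬ side k = false)) = univ.filter (fun k : Fin K => side k = true) := by
      ext k; simp
    rw [h2, Finset.card_univ, Fintype.card_fin] at h1
    exact h1
  rw [hone, one_mul] at h
  have : (univ.filter (fun k : Fin K => side k = true)).card = K - 1 := by omega
  rw [this] at h
  exact h


/-- **PARALLEL LETTERS NEVER PRODUCE A ROOT** (one direction only): if every letter is a non-negative multiple of the same
`v vᵀ`, `det J ≤ 0` and `m(J,v) ≤ 0`, then `det F` has NO positive root (every coefficient is `≤ 0`). [folklore] -/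
theorem posRoots_eq_zero_of_parallel (e : ℕ) (d : Fin K → ℕ) (J : Matrix (Fin 2) (Fin 2) ℝ) (v : Fin 2 → ℝ)
    (c : Fin K → ℝ) (hc : ∀ k, 0 ≤ c k) (P : Fin K → Matrix (Fin 2) (Fin 2) ℝ)
    (hP : ∀ k, P k = c k • vecMulVec v v) (hJ : J.det ≤ 0)
    (hv : J 0 0 * v 1 ^ 2 + J 1 1 * v 0 ^ 2 - (J 0 1 + J 1 0) * (v 0 * v 1) ≤ 0) :
    ((Matrix.det (((X : ℝ[X]) ^ e) • J.map Polynomial.C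
        + ∑ k, ((X : ℝ[X]) ^ d k) • (P k).map Polynomial.C)).roots.toFinset.filter (fun t => 0 < t)).card = 0 := by
  classical
  have h := posRoots_le_two_mul_sides e d J (fun _ => v) (fun _ => true) c hc P (fun k => hP k) hJ hv hv
  have h0 : (univ.filter (fun _ : Fin K => true = false)).card = 0 := by simp
  rw [h0, zero_mul, mul_zero] at h
  exact Nat.le_zero.1 h

/-- **Two-direction `(2,4)` pencils satisfy the open row's bound `8`**: two letters in each direction ⇒ `Z₊ ≤ 8 = 2K`
(so the open content of the `(2,4)₁` cell — nine or ten roots — needs at least THREE letter directions). [folklore] -/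
theorem posRoots_le_eight_of_twoTwo (e : ℕ) (d : Fin K → ℕ) (J : Matrix (Fin 2) (Fin 2) ℝ) (w : Bool → (Fin 2 → ℝ))
    (side : Fin K → Bool) (c : Fin K → ℝ) (hc : ∀ k, 0 ≤ c k) (P : Fin K → Matrix (Fin 2) (Fin 2) ℝ)
    (hP : ∀ k, P k = c k • vecMulVec (w (side k)) (w (side k))) (hJ : J.det ≤ 0)
    (hu : J 0 0 * w false 1 ^ 2 + J 1 1 * w false 0 ^ 2 - (J 0 1 + J 1 0) * (w false 0 * w false 1) ≤ 0)
    (hv : J 0 0 * w true 1 ^ 2 + J 1 1 * w true 0 ^ 2 - (J 0 1 + J 1 0) * (w true 0 * w true 1) ≤ 0)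
    (htwo : (univ.filter (fun k => side k = false)).card = 2) (htwo' : (univ.filter (fun k => side k = true)).card = 2) :
    ((Matrix.det (((X : ℝ[X]) ^ e) • J.map Polynomial.C
        + ∑ k, ((X : ℝ[X]) ^ d k) • (P k).map Polynomial.C)).roots.toFinset.filter (fun t => 0 < t)).card ≤ 8 := by
  have h := posRoots_le_two_mul_sides e d J w side c hc P hP hJ hu hv
  rw [htwo, htwo'] at h
  exact h

/-! ## 5. The BLOCK FACTORISATION (normal form of the two-direction determinant) -/

/-- **Block factorisation.**  With `Δ = u₀v₁ − u₁v₀`, `m_u = m(J,u)`, `m_v = m(J,v)` and the direction polynomials `f, g`: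
`Δ² · det (X^e J + f u uᵀ + g v vᵀ) = (Δ² f + m_v X^e)(Δ² g + m_u X^e) + X^{2e} (Δ² det J − m_u m_v)`.
In the hard cell (`m_u, m_v, det J < 0`) this reads, for `x > 0`, `(F(x) − 1)(G(x) − 1) = μ²` with
`F = Δ² f /(|m_v| x^e)`, `G = Δ² g/(|m_u| x^e)` and `μ² = 1 + Δ²|det J|/(m_u m_v) > 1`: the root count of a two-direction
pencil is the number of solutions of ONE scalar equation in the two direction posynomials (the «block» normal form of the
tree's arrowhead certificates `…PivotTwoFiveTen`, `…PivotTwoSixTwelve`, whose letters are `[[a/U, ±a],[±a, aU]]`, i.e. the two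
directions `(1, ±U)`, balanced: `m_u = m_v = −1`). [folklore] -/
theorem block_factorisation (e : ℕ) (J : Matrix (Fin 2) (Fin 2) ℝ) (u v : Fin 2 → ℝ) (f g : ℝ[X]) :
    Polynomial.C ((u 0 * v 1 - u 1 * v 0) ^ 2)
        * Matrix.det (((X : ℝ[X]) ^ e) • J.map Polynomial.C + f • (vecMulVec u u).map Polynomial.C
            + g • (vecMulVec v v).map Polynomial.C)
      = (Polynomial.C ((u 0 * v 1 - u 1 * v 0) ^ 2) * f
            + Polynomial.C (J 0 0 * v 1 ^ 2 + J 1 1 * v 0 ^ 2 - (J 0 1 + J 1 0) * (v 0 * v 1)) * (X : ℝ[X]) ^ e)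
          * (Polynomial.C ((u 0 * v 1 - u 1 * v 0) ^ 2) * g
            + Polynomial.C (J 0 0 * u 1 ^ 2 + J 1 1 * u 0 ^ 2 - (J 0 1 + J 1 0) * (u 0 * u 1)) * (X : ℝ[X]) ^ e)
        + (X : ℝ[X]) ^ (2 * e) * Polynomial.C ((u 0 * v 1 - u 1 * v 0) ^ 2 * J.det
            - (J 0 0 * u 1 ^ 2 + J 1 1 * u 0 ^ 2 - (J 0 1 + J 1 0) * (u 0 * u 1))
              * (J 0 0 * v 1 ^ 2 + J 1 1 * v 0 ^ 2 - (J 0 1 + J 1 0) * (v 0 * v 1))) := by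
  rw [det_twoDir]
  simp only [map_sub, map_mul, map_pow, map_add]
  ring

/-- **Block normal form at a point.**  For `x > 0`, in the hard cell (`m_u, m_v < 0`), `det F(x) = 0` iff
`(Δ² f(x) − |m_v| x^e) · (Δ² g(x) − |m_u| x^e) = x^{2e} · (m_u m_v − Δ² det J)` (evaluate `block_factorisation`). [folklore] -/
theorem eval_det_eq_zero_iff_block (e : ℕ) (J : Matrix (Fin 2) (Fin 2) ℝ) (u v : Fin 2 → ℝ) (f g : ℝ[X])
    (hΔ : u 0 * v 1 - u 1 * v 0 ≠ 0) (x : ℝ) :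
    (Matrix.det (((X : ℝ[X]) ^ e) • J.map Polynomial.C + f • (vecMulVec u u).map Polynomial.C
            + g • (vecMulVec v v).map Polynomial.C)).eval x = 0 ↔
      ((u 0 * v 1 - u 1 * v 0) ^ 2 * f.eval x
          + (J 0 0 * v 1 ^ 2 + J 1 1 * v 0 ^ 2 - (J 0 1 + J 1 0) * (v 0 * v 1)) * x ^ e)
        * ((u 0 * v 1 - u 1 * v 0) ^ 2 * g.eval x
          + (J 0 0 * u 1 ^ 2 + J 1 1 * u 0 ^ 2 - (J 0 1 + J 1 0) * (u 0 * u 1)) * x ^ e)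
      = x ^ (2 * e) * ((J 0 0 * u 1 ^ 2 + J 1 1 * u 0 ^ 2 - (J 0 1 + J 1 0) * (u 0 * u 1))
              * (J 0 0 * v 1 ^ 2 + J 1 1 * v 0 ^ 2 - (J 0 1 + J 1 0) * (v 0 * v 1))
            - (u 0 * v 1 - u 1 * v 0) ^ 2 * J.det) := by
  have h := congrArg (Polynomial.eval x) (block_factorisation e J u v f g)
  simp only [Polynomial.eval_mul, Polynomial.eval_C, Polynomial.eval_add, Polynomial.eval_pow, Polynomial.eval_X] at h
  have hΔ2 : (u 0 * v 1 - u 1 * v 0) ^ 2 ≠ 0 := pow_ne_zero 2 hΔ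
  constructor
  · intro h0
    rw [h0, mul_zero] at h
    linarith
  · intro h1
    have : (u 0 * v 1 - u 1 * v 0) ^ 2 * (Matrix.det (((X : ℝ[X]) ^ e) • J.map Polynomial.C
        + f • (vecMulVec u u).map Polynomial.C + g • (vecMulVec v v).map Polynomial.C)).eval x = 0 := by
      rw [h]; linarith
    rcases mul_eq_zero.1 this with h2 | h2
    · exact absurd h2 hΔ2
    · exact h2


/-! ## 6. Pivot currency: the letters of the family are PSD, so the counts are statements about `pivotPosRoots` -/

/-- A non-negative multiple of `w wᵀ` is positive semidefinite. [folklore] -/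
theorem posSemidef_smul_vecMulVec (c : ℝ) (hc : 0 ≤ c) (w : Fin 2 → ℝ) : (c • vecMulVec w w).PosSemidef := by
  have h : (vecMulVec w (star w)).PosSemidef := Matrix.posSemidef_vecMulVec_self_star w
  rw [star_trivial] at h
  exact h.smul hc

/-- **Two-direction count in pivot currency**: `pivotPosRoots e d J P ≤ 2 · K_u · K_v` for a two-direction family with
`det J ≤ 0` and both pairings `≤ 0` (no index hypothesis is needed; the letters are automatically PSD). [folklore] -/
theorem pivotPosRoots_le_two_mul_sides (e : ℕ) (d : Fin K → ℕ) (J : Matrix (Fin 2) (Fin 2) ℝ) (w : Bool → (Fin 2 → ℝ))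
    (side : Fin K → Bool) (c : Fin K → ℝ) (hc : ∀ k, 0 ≤ c k) (P : Fin K → Matrix (Fin 2) (Fin 2) ℝ)
    (hP : ∀ k, P k = c k • vecMulVec (w (side k)) (w (side k))) (hJ : J.det ≤ 0)
    (hu : J 0 0 * w false 1 ^ 2 + J 1 1 * w false 0 ^ 2 - (J 0 1 + J 1 0) * (w false 0 * w false 1) ≤ 0)
    (hv : J 0 0 * w true 1 ^ 2 + J 1 1 * w true 0 ^ 2 - (J 0 1 + J 1 0) * (w true 0 * w true 1) ≤ 0) :
    pivotPosRoots e d J P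
      ≤ 2 * ((univ.filter (fun k => side k = false)).card * (univ.filter (fun k => side k = true)).card) :=
  posRoots_le_two_mul_sides e d J w side c hc P hP hJ hu hv

/-- **One letter against a parallel pencil, pivot currency**: `pivotPosRoots e d J P ≤ 2(K − 1)`. [folklore] -/
theorem pivotPosRoots_le_of_one_against_parallel (e : ℕ) (d : Fin K → ℕ) (J : Matrix (Fin 2) (Fin 2) ℝ)
    (w : Bool → (Fin 2 → ℝ)) (side : Fin K → Bool) (c : Fin K → ℝ) (hc : ∀ k, 0 ≤ c k)
    (P : Fin K → Matrix (Fin 2) (Fin 2) ℝ) (hP : ∀ k, P k = c k • vecMulVec (w (side k)) (w (side k)))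
    (hJ : J.det ≤ 0)
    (hu : J 0 0 * w false 1 ^ 2 + J 1 1 * w false 0 ^ 2 - (J 0 1 + J 1 0) * (w false 0 * w false 1) ≤ 0)
    (hv : J 0 0 * w true 1 ^ 2 + J 1 1 * w true 0 ^ 2 - (J 0 1 + J 1 0) * (w true 0 * w true 1) ≤ 0)
    (hone : (univ.filter (fun k => side k = false)).card = 1) :
    pivotPosRoots e d J P ≤ 2 * (K - 1) :=
  posRoots_le_of_one_against_parallel e d J w side c hc P hP hJ hu hv hone

end Summit.ValiantsHypothesis.ValiantsHypothesis.Theorems.LacunarySymmetroidMatrixDescartes.Pivot.TwoDirections
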